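import Summits.HubbardSuperconductivity.HubbardSuperconductivity.Theses.AbsenceCertificate
import Summits.HubbardSuperconductivity.HubbardSuperconductivity.Theorems.ChiralWindowCwSsbToEvenTorusLROCanonicalSupportingPotential
import HarnessLib

/-!
# Route `AbsenceCertificate`, item stmt-HubbardSuperconductivity-9491 `CanonicalSupportingPotential` — CLOSED by the
line `griffiths-block-slope` of crux `CwSsbToEvenTorusLRO` (stmt-HubbardSuperconductivity-10439)

The registered stub `stub_canonicalSupportingPotential` of that line (landed as
`Theorems/ChiralWindowCwSsbToEvenTorusLROCanonicalSupportingPotential.lean`, p85009; thermodynamic limit and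
convexity of the canonical energy density in `…CanonicalEnergyDensity.lean`, p83595) is VERBATIM the statement of
`AbsenceCertificate.CanonicalSupportingPotential` (T = 0 equivalence of ensembles on the even Hubbard tori at a
subgradient `μ` of the canonical energy density at `1 - δ`; Ruelle 1969 §3.4), so the route item follows by `Iff.rfl`.
-/

namespace Summit.HubbardSuperconductivity.HubbardSuperconductivity.Theorems

/-- **Item stmt-HubbardSuperconductivity-9491** (`AbsenceCertificate.CanonicalSupportingPotential`): for every real `U`
and `δ ∈ (0,1)` there is `μ` with `|E_sec(N_L) - μN_L - E₀(K_μ)| ≤ εL²` for all even `L ≥ L₀(ε)`,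
`N_L = 2⌊(1-δ)L²/2⌋` — by the landed stub theorem of line `griffiths-block-slope` (definitionally the same statement).
[cite: Ruelle1969, §3.4] -/
theorem canonicalSupportingPotential_proof :
    Summit.HubbardSuperconductivity.HubbardSuperconductivity.Theses.AbsenceCertificate.CanonicalSupportingPotential :=
  CwSsbToEvenTorusLRO.stub_canonicalSupportingPotential

end Summit.HubbardSuperconductivity.HubbardSuperconductivity.Theorems
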